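import Literature.MathematicalPhysics.QuantumFieldTheory.Balaban1983to89.B9Thm37KLetterDir

/-!
# `Balaban1983to89.B9RWSums344InputPairDir` — the (3.44)∕(3.45) input members of Theorem 3.7's sum G′(U), per direction pair, OVER THE DIRECTION LETTERS
# (ruling R1′): n06-k's `B9RWSums344InputPair.{inputPair3445_of_local37, inputPair3445_family_37}` with `Identities₂`, `fixedPoint_dir`, `KopDir` and
# `FactorsInputPair37Dir` — engine re-thread (A3), file 4

T. Bałaban, *Propagators for lattice gauge theories in a background field*, Commun. Math. Phys. **99** (1985) 389–434
[`Balaban1985BackgroundPropagators`, "B9"], Thm 3.7 (3.87)–(3.90) pp. 408–410, (3.44)–(3.45) p. 398, (3.42)–(3.43) pp. 397–398, (3.39) p. 397; T. Bałaban,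
*Propagators and renormalization transformations for lattice gauge theories. II*, Commun. Math. Phys. **96** (1984) 223–250 [`Balaban1984PropagatorsII`, "[4]"],
(2.52)–(2.55) p. 232, Lemma 2.1 p. 234.

statement-level skeleton of published theorems with citation tags; proofs where landed; nothing here is a claim about the
Yang–Mills mass gap

WHY THIS FILE (cell `pub-ymgap`, Track A node N06 [B9], rows 18–19; dag-n06-d g10 «re-thread the engine over Identities₂»; seat `pub-ymgap-dag-n06-c` g10).
Recipe of `B9RWSums346TwoGpDir`: `hi : Identities₂`, `hfix := fixedPoint_dir hi`, K-letter `KopDir` in `factorsPair37_sum` and in the (3.88) sandwich, schema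
`FactorsInputPair37Dir`; the private algebra helpers of the v1 file are copied (private there).  Statements, constants (`inputConst44∕45`) and every other
hypothesis (`InputLegsPair37`, `DirSup37`, `DirSupHolder37`, h1, h2) verbatim.

HONEST SCOPE.  Majorant bookkeeping over n06-k's landed calculus; legs, factor bounds and (3.88) are HYPOTHESES (schemas); nothing of [B9] asserted; COUNT-NEUTRAL;
N06 NOT discharged; one finite lattice programme — nothing continuum, nothing about OS positivity or the mass gap.
-/

namespace Literature.MathematicalPhysics.QuantumFieldTheory.Balaban1983to89.B9RWSums344InputPairDir

open Finset B6RandomWalk B6RandomWalkHom B9Thm37Sum B9Thm34Ext B9Thm37Glue B9Thm37Whole B9Cor38Whole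
open B9RWSums343to347Whole B9RWSums346Schur B9Thm37GlueCor36 B9RWSums343Holder B9RWSums344Input B9RWSums344InputGp
open B11SectG B9Thm37AllNorms B9Thm37AllNormsInstances B9SectDL2Decay B9RWSums346SecondDiff B9RWSums346SecondDiffGp B9RWSums346MixedPair
open B9RWSums344InputFam B9RWSums344InputPair B9Thm37WholeDir B9Thm37KLetterDir

noncomputable section

section Algebra

variable {X : Type}

/-- Algebra of (3.106)∕(3.88) read between a left member and an operator on the right. [folklore] -/
private theorem sandwich_split' {Z : Type} {E : (X → ℝ) →ₗ[ℝ] (Z → ℝ)} {Dst G G0 W : Module.End ℝ (X → ℝ)} (h : G = G0 + G * W) :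
    E ∘ₗ (G ∘ₗ Dst) = E ∘ₗ (G0 ∘ₗ Dst) + (E ∘ₗ G) ∘ₗ (W ∘ₗ Dst) := by
  conv_lhs => rw [h]
  apply LinearMap.ext
  intro f
  simp only [LinearMap.comp_apply, LinearMap.add_apply, Module.End.mul_apply, map_add]

/-- a left member distributes over a finite sum composed on the right. [folklore] -/
private theorem comp_sum_comp' {Z ι : Type} [Fintype ι] (E : (X → ℝ) →ₗ[ℝ] (Z → ℝ)) (Dst : Module.End ℝ (X → ℝ))
    (T : ι → Module.End ℝ (X → ℝ)) : E ∘ₗ ((∑ i, T i) ∘ₗ Dst) = ∑ i, E ∘ₗ (T i ∘ₗ Dst) := by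
  apply LinearMap.ext
  intro f
  simp only [LinearMap.comp_apply, LinearMap.sum_apply, map_sum]

/-- a finite sum of operators composed on the right. [folklore] -/
private theorem sum_comp'' {ι : Type} [Fintype ι] (Dst : Module.End ℝ (X → ℝ)) (T : ι → Module.End ℝ (X → ℝ)) :
    (∑ i, T i) ∘ₗ Dst = ∑ i, T i ∘ₗ Dst := by
  apply LinearMap.ext
  intro f
  simp only [LinearMap.comp_apply, LinearMap.sum_apply]

end Algebra

section GpSide

variable {g : B9.Geometry} [Fintype g.Site] [DecidableEq g.Site] {R : ℝ} {H : Prop} {B : B9.Backgrounds}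
variable {X Y ι P PX PY : Type} [Fintype P]

/-- The terms of R′∇\*_μ from `bHX ε`, summed with N′. [cite: Balaban1985BackgroundPropagators, (3.88)–(3.89) p.409] -/
private theorem factorsPair37_sum [Fintype X] [Fintype ι] {𝔬 : Ops g B X Y ι} {𝔡 : DirOps37 𝔬 P} {𝔩 : DirLetters37 𝔬 P}
    {bHX : ℝ → BlockNorm (toB6 g R H) (X → ℝ)} {θI : ℝ → ℝ} {δ₀ : ℝ} {U : B.Cfg} {N' ε : ℝ}
    (hFI : FactorsInputPair37Dir 𝔬 𝔡 𝔩 R H bHX θI δ₀ U) (hε : 0 < ε) (hθ : 0 ≤ θI ε) (hlen : ∀ y : g.Site, 0 ≤ g.len y)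
    (hcnt' : ∀ a : g.Site, (∑ i, if a ∈ 𝔬.S' i then (1 : ℝ) else 0) ≤ N') (μ : P) :
    HasMaj (bHX ε) (BlockNorm.ofBlocks (toB6 g R H) 𝔬.blk)
      ((∑ i, KopDir 𝔬 𝔡 𝔩 U i * 𝔬.Gsq U i * mulOp (𝔬.h i)) ∘ₗ 𝔡.Dsd U μ)
      (fun (y y' : g.Site) => N' * θI ε * (g.len y)⁻¹ * Real.exp (-(δ₀ * g.dist y y'))) := by
  rw [sum_comp'']
  have h := hasMaj_localSum (G := toB6 g R H)
    (fun i => (KopDir 𝔬 𝔡 𝔩 U i * 𝔬.Gsq U i * mulOp (𝔬.h i)) ∘ₗ 𝔡.Dsd U μ)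
    (fun i (y : g.Site) => if y ∈ 𝔬.S' i then (1 : ℝ) else 0)
    (fun (y y' : g.Site) => θI ε * (g.len y)⁻¹ * Real.exp (-(δ₀ * g.dist y y'))) N'
    (fun y y' => mul_nonneg (mul_nonneg hθ (inv_nonneg.mpr (hlen y))) (Real.exp_nonneg _)) (fun i => hFI.facDs ε hε i μ) hcnt'
  exact h.mono fun y y' => le_of_eq (by ring)

/-- ★★ **(v2 OVER THE DIRECTION LETTERS — `Identities₂`, `fixedPoint_dir`, `KopDir`, `FactorsInputPair37Dir`; otherwise verbatim `B9RWSums344InputPair.inputPair3445_of_local37`.) THE (3.44)∕(3.45) MEMBERS OF THE SUM G′(U) OF (3.90), PER DIRECTION PAIR** — (3.88) G′ = G′₀ + G′R′ read between ∇_ν and ∇\*_μ; the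
input legs summed with N_I; the component ∇_νG′ of the bundled (3.42) sup majorant resp. the component Φ^X_β∘∇_νG′ of the bundled (3.43) probe
majorant; the terms of R′∇\*_μ from `bHX` summed with N′; `tail_comp`.  Constants `inputConst44 d₁ δ₁ α₁ N_I N′ C L₀ …`, `inputConst45 … (h_c β) …`.
[cite: Balaban1985BackgroundPropagators, Thm 3.7 (3.87)–(3.90) pp.408–410 + (3.44)–(3.45) p.398 + (3.42)–(3.43) pp.397–398; Balaban1984PropagatorsII, (2.52)–(2.55) p.232 + Lemma 2.1 p.234] -/
theorem inputPair3445_of_local37_dir [Fintype X] [DecidableEq X] [Fintype Y] [Fintype ι] [Fintype PX] [Fintype PY]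
    (𝔬 : Ops g B X Y ι) (𝔡 : DirOps37 𝔬 P) (𝔩 : DirLetters37 𝔬 P) (𝔭 : HolderProbes g B X Y PX PY) (R : ℝ) (H : Prop)
    (bHX : ℝ → BlockNorm (toB6 g R H) (X → ℝ)) (d d₁ : ℕ) (δ α L₀ δ₁ α₁ ρ N N' Cℓ NI C : ℝ) (κ : Sizes)
    (SI : ι → Finset g.Site) (hc BI θI : ℝ → ℝ) (BI2 : ℝ → ℝ → ℝ) (U : B.Cfg)
    (hδ₁ : 0 ≤ δ₁) (hα₁ : 0 ≤ α₁) (hN' : 0 ≤ N') (hNI : 0 ≤ NI) (hC : 0 ≤ C)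
    (hδle : δ ≤ (1 - α₁) * δ₁) (hαδ : 0 ≤ α * δ) (hαδ1 : α * δ ≤ δ)
    (hs : StaticOK 𝔬 ρ N N' Cℓ κ) (hcntI : ∀ a : g.Site, (∑ i, if a ∈ SI i then (1 : ℝ) else 0) ≤ NI)
    (hhc : ∀ β, 0 ≤ β → β < 1 → 0 ≤ hc β) (hBI : ∀ ε, 0 < ε → ε ≤ 1 → 0 ≤ BI ε)
    (hBI2 : ∀ ε β, 0 < ε → ε ≤ 1 → 0 ≤ β → β < 1 → 0 ≤ BI2 ε β) (hθI : ∀ ε, 0 < ε → 0 ≤ θI ε)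
    (h261 : Ineq261 d₁ (toB6 g R H) δ₁ α₁) (hF : Facts347 g R H d δ α L₀) (hi : Identities₂ 𝔬 𝔡 𝔩 R H U)
    (hIL : InputLegsPair37 𝔬 𝔡 𝔭 R H bHX SI BI BI2 δ₁ U) (hFI : FactorsInputPair37Dir 𝔬 𝔡 𝔩 R H bHX θI δ₁ U)
    (hDS : DirSup37 𝔬 𝔡 R H U) (hDH : DirSupHolder37 𝔬 𝔡 𝔭 R H U)
    (h1 : HasMajorantHom (g := toB6 g R H) 𝔬.blk 𝔬.blkY (𝔬.D U ∘ₗ 𝔬.Gp U)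
      (fun (a b : g.Site) => C * g.len a * Real.exp (-(δ * g.dist a b))))
    (hHol : ∀ β : ℝ, 0 ≤ β → β < 1 → HasMajorantHom (g := toB6 g R H) 𝔬.blk 𝔭.blkPY ((𝔭.ΦY U β ∘ₗ 𝔬.D U) ∘ₗ 𝔬.Gp U)
      (fun (a b : g.Site) => hc β * g.len a ^ (1 - β) * Real.exp (-(δ * g.dist a b)))) (ν μ : P) :
    (∀ ε : ℝ, 0 < ε → ε ≤ 1 → HasMaj (bHX ε) (BlockNorm.ofBlocks (toB6 g R H) 𝔬.blk) (𝔡.Dd U ν ∘ₗ (𝔬.Gp U ∘ₗ 𝔡.Dsd U μ))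
        (fun (a b : g.Site) => inputConst44 d₁ δ₁ α₁ NI N' C L₀ (BI ε) (θI ε) * Real.exp (-((1 - α) * δ * g.dist a b)))) ∧
      (∀ ε β : ℝ, 0 < ε → ε ≤ 1 → 0 ≤ β → β < 1 →
        HasMaj (bHX (β + ε)) (BlockNorm.ofBlocks (toB6 g R H) 𝔭.blkPX) (𝔭.ΦX U β ∘ₗ (𝔡.Dd U ν ∘ₗ (𝔬.Gp U ∘ₗ 𝔡.Dsd U μ)))
          (fun (a b : g.Site) => inputConst45 d₁ δ₁ α₁ NI N' L₀ (hc β) (BI2 ε β) (θI (β + ε)) * g.len a ^ (-β) *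
            Real.exp (-((1 - α) * δ * g.dist a b)))) := by
  have hlen0 : ∀ y : g.Site, 0 ≤ g.len y := fun y => (hs.lenpos y).le
  have htri : Triangle254 (toB6 g R H) := fun a b c => hs.tri a b c
  have hc1 : 0 ≤ B6.c1 d₁ δ₁ α₁ := c1_nonneg d₁ δ₁ α₁
  have hL₀ : 0 ≤ L₀ := le_trans (le_trans zero_le_one hF.one_le_L) hF.L_le
  have hαδ₁ : 0 ≤ α₁ * δ₁ := mul_nonneg hα₁ hδ₁
  have hrate : (1 - α) * δ ≤ (1 - α₁) * δ₁ := by nlinarith [hαδ, hδle]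
  have hexp : ∀ a b : g.Site, Real.exp (-(δ₁ * g.dist a b)) ≤ Real.exp (-((1 - α) * δ * g.dist a b)) := fun a b =>
    Real.exp_le_exp.mpr (neg_le_neg (mul_le_mul_of_nonneg_right (by nlinarith [hrate, hαδ₁]) (hs.dnn a b)))
  have hfix : 𝔬.Gp U = (∑ i, mulOp (𝔬.h i) * 𝔬.Gsq U i * mulOp (𝔬.h i)) +
      𝔬.Gp U * ∑ i, KopDir 𝔬 𝔡 𝔩 U i * 𝔬.Gsq U i * mulOp (𝔬.h i) :=
    fixedPoint_dir hi
  refine ⟨fun ε hε0 hε1 => ?_, fun ε β hε0 hε1 hβ0 hβ1 => ?_⟩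
  · have hθ : 0 ≤ θI ε := hθI ε hε0
    have hP := factorsPair37_sum hFI hε0 hθ hlen0 hs.cnt' μ
    have hS : HasMajorantHom (g := toB6 g R H) 𝔬.blk 𝔬.blk (𝔡.Dd U ν ∘ₗ 𝔬.Gp U)
        (fun (a b : g.Site) => C * (g.len a ^ (0 : ℝ) * g.len a) * Real.exp (-(δ * g.dist a b))) :=
      hasMajorantHom_mono (g := toB6 g R H) 𝔬.blk 𝔬.blk (hDS.left _ h1 ν) fun a b => le_of_eq (by rw [Real.rpow_zero, one_mul])
    have htail := tail_comp (bHX ε) 𝔬.blk 𝔬.blk hF h261 htri hs.symm hs.dnn hs.lenpos hC (mul_nonneg hN' hθ) hαδ1 hrate hS hP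
    have hhead := hasMaj_localSum (G := toB6 g R H)
      (fun i => 𝔡.Dd U ν ∘ₗ ((mulOp (𝔬.h i) * 𝔬.Gsq U i * mulOp (𝔬.h i)) ∘ₗ 𝔡.Dsd U μ))
      (fun i (a : g.Site) => if a ∈ SI i then (1 : ℝ) else 0)
      (fun (a b : g.Site) => BI ε * Real.exp (-(δ₁ * g.dist a b))) NI
      (fun a b => mul_nonneg (hBI ε hε0 hε1) (Real.exp_nonneg _)) (fun i => hIL.e4 ε hε0 hε1 i ν μ) hcntI
    rw [sandwich_split' hfix, comp_sum_comp']
    refine (hhead.add htail).mono fun a b => ?_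
    have hK0 : 0 ≤ NI * BI ε := mul_nonneg hNI (hBI ε hε0 hε1)
    calc NI * (BI ε * Real.exp (-(δ₁ * g.dist a b))) +
          C * (N' * θI ε) * L₀ * B6.c1 d₁ δ₁ α₁ * g.len a ^ (0 : ℝ) * Real.exp (-((1 - α) * δ * g.dist a b))
        = NI * BI ε * Real.exp (-(δ₁ * g.dist a b)) +
          C * (N' * θI ε) * L₀ * B6.c1 d₁ δ₁ α₁ * Real.exp (-((1 - α) * δ * g.dist a b)) := by
          rw [Real.rpow_zero]; ring
      _ ≤ NI * BI ε * Real.exp (-((1 - α) * δ * g.dist a b)) +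
          C * (N' * θI ε) * L₀ * B6.c1 d₁ δ₁ α₁ * Real.exp (-((1 - α) * δ * g.dist a b)) :=
          add_le_add (mul_le_mul_of_nonneg_left (hexp a b) hK0) le_rfl
      _ = inputConst44 d₁ δ₁ α₁ NI N' C L₀ (BI ε) (θI ε) * Real.exp (-((1 - α) * δ * g.dist a b)) := by
          unfold inputConst44; ring
  · have hβε : 0 < β + ε := by linarith
    have hθ : 0 ≤ θI (β + ε) := hθI (β + ε) hβε
    have hP := factorsPair37_sum hFI hβε hθ hlen0 hs.cnt' μ
    have hHK : 0 ≤ hc β := hhc β hβ0 hβ1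
    have hS : HasMajorantHom (g := toB6 g R H) 𝔬.blk 𝔭.blkPX ((𝔭.ΦX U β ∘ₗ 𝔡.Dd U ν) ∘ₗ 𝔬.Gp U)
        (fun (a b : g.Site) => hc β * (g.len a ^ (-β) * g.len a) * Real.exp (-(δ * g.dist a b))) := by
      refine hasMajorantHom_mono (g := toB6 g R H) 𝔬.blk 𝔭.blkPX (hDH.probe β _ (hHol β hβ0 hβ1) ν) fun a b => le_of_eq ?_
      have hr : g.len a ^ (1 - β) = g.len a ^ (-β) * g.len a := by
        rw [show (1 - β : ℝ) = -β + 1 by ring, Real.rpow_add (hs.lenpos a), Real.rpow_one]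
      rw [hr]
    have htail := tail_comp (bHX (β + ε)) 𝔬.blk 𝔭.blkPX hF h261 htri hs.symm hs.dnn hs.lenpos hHK (mul_nonneg hN' hθ) hαδ1
      hrate hS hP
    have hhead := hasMaj_localSum (G := toB6 g R H)
      (fun i => (𝔭.ΦX U β ∘ₗ 𝔡.Dd U ν) ∘ₗ ((mulOp (𝔬.h i) * 𝔬.Gsq U i * mulOp (𝔬.h i)) ∘ₗ 𝔡.Dsd U μ))
      (fun i (a : g.Site) => if a ∈ SI i then (1 : ℝ) else 0)
      (fun (a b : g.Site) => BI2 ε β * g.len a ^ (-β) * Real.exp (-(δ₁ * g.dist a b))) NI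
      (fun a b => mul_nonneg (mul_nonneg (hBI2 ε β hε0 hε1 hβ0 hβ1) (Real.rpow_nonneg (hlen0 a) _)) (Real.exp_nonneg _))
      (fun i => hIL.h2 ε β hε0 hε1 hβ0 hβ1 i ν μ) hcntI
    have hassoc : 𝔭.ΦX U β ∘ₗ (𝔡.Dd U ν ∘ₗ (𝔬.Gp U ∘ₗ 𝔡.Dsd U μ)) = (𝔭.ΦX U β ∘ₗ 𝔡.Dd U ν) ∘ₗ (𝔬.Gp U ∘ₗ 𝔡.Dsd U μ) := by
      rw [LinearMap.comp_assoc]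
    rw [hassoc, sandwich_split' hfix, comp_sum_comp']
    refine (hhead.add htail).mono fun a b => ?_
    have hW : 0 ≤ g.len a ^ (-β) := Real.rpow_nonneg (hlen0 a) _
    have hK0 : 0 ≤ NI * BI2 ε β * g.len a ^ (-β) := mul_nonneg (mul_nonneg hNI (hBI2 ε β hε0 hε1 hβ0 hβ1)) hW
    calc NI * (BI2 ε β * g.len a ^ (-β) * Real.exp (-(δ₁ * g.dist a b))) +
          hc β * (N' * θI (β + ε)) * L₀ * B6.c1 d₁ δ₁ α₁ * g.len a ^ (-β) * Real.exp (-((1 - α) * δ * g.dist a b))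
        = NI * BI2 ε β * g.len a ^ (-β) * Real.exp (-(δ₁ * g.dist a b)) +
          hc β * (N' * θI (β + ε)) * L₀ * B6.c1 d₁ δ₁ α₁ * (g.len a ^ (-β) * Real.exp (-((1 - α) * δ * g.dist a b))) := by ring
      _ ≤ NI * BI2 ε β * g.len a ^ (-β) * Real.exp (-((1 - α) * δ * g.dist a b)) +
          hc β * (N' * θI (β + ε)) * L₀ * B6.c1 d₁ δ₁ α₁ * (g.len a ^ (-β) * Real.exp (-((1 - α) * δ * g.dist a b))) :=
          add_le_add (mul_le_mul_of_nonneg_left (hexp a b) hK0) le_rfl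
      _ = inputConst45 d₁ δ₁ α₁ NI N' L₀ (hc β) (BI2 ε β) (θI (β + ε)) * g.len a ^ (-β) *
            Real.exp (-((1 - α) * δ * g.dist a b)) := by
          unfold inputConst45; ring


/-- ★★ **(v2 over the direction letters.) THE PACKAGED FAMILY ∇_{U,ν}G′∇\*_{U,μ} OVER P × P HAS THE SAME (3.44)∕(3.45) MAJORANTS** (`B9RWSums344InputPair.inputPair3445_family_37` with `Identities₂`∕`FactorsInputPair37Dir`).
[cite: Balaban1985BackgroundPropagators, (3.44)–(3.45) p.398 + (3.39) p.397] -/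
theorem inputPair3445_family_37_dir [Fintype X] [DecidableEq X] [Fintype Y] [Fintype ι] [Fintype PX] [Fintype PY]
    (𝔬 : Ops g B X Y ι) (𝔡 : DirOps37 𝔬 P) (𝔩 : DirLetters37 𝔬 P) (𝔭 : HolderProbes g B X Y PX PY) (R : ℝ) (H : Prop)
    (bHX : ℝ → BlockNorm (toB6 g R H) (X → ℝ)) (d d₁ : ℕ) (δ α L₀ δ₁ α₁ ρ N N' Cℓ NI C : ℝ) (κ : Sizes)
    (SI : ι → Finset g.Site) (hc BI θI : ℝ → ℝ) (BI2 : ℝ → ℝ → ℝ) (U : B.Cfg)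
    (hδ₁ : 0 ≤ δ₁) (hα₁ : 0 ≤ α₁) (hN' : 0 ≤ N') (hNI : 0 ≤ NI) (hC : 0 ≤ C)
    (hδle : δ ≤ (1 - α₁) * δ₁) (hαδ : 0 ≤ α * δ) (hαδ1 : α * δ ≤ δ)
    (hs : StaticOK 𝔬 ρ N N' Cℓ κ) (hcntI : ∀ a : g.Site, (∑ i, if a ∈ SI i then (1 : ℝ) else 0) ≤ NI)
    (hhc : ∀ β, 0 ≤ β → β < 1 → 0 ≤ hc β) (hBI : ∀ ε, 0 < ε → ε ≤ 1 → 0 ≤ BI ε)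
    (hBI2 : ∀ ε β, 0 < ε → ε ≤ 1 → 0 ≤ β → β < 1 → 0 ≤ BI2 ε β) (hθI : ∀ ε, 0 < ε → 0 ≤ θI ε)
    (h261 : Ineq261 d₁ (toB6 g R H) δ₁ α₁) (hF : Facts347 g R H d δ α L₀) (hi : Identities₂ 𝔬 𝔡 𝔩 R H U)
    (hIL : InputLegsPair37 𝔬 𝔡 𝔭 R H bHX SI BI BI2 δ₁ U) (hFI : FactorsInputPair37Dir 𝔬 𝔡 𝔩 R H bHX θI δ₁ U)
    (hDS : DirSup37 𝔬 𝔡 R H U) (hDH : DirSupHolder37 𝔬 𝔡 𝔭 R H U)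
    (h1 : HasMajorantHom (g := toB6 g R H) 𝔬.blk 𝔬.blkY (𝔬.D U ∘ₗ 𝔬.Gp U)
      (fun (a b : g.Site) => C * g.len a * Real.exp (-(δ * g.dist a b))))
    (hHol : ∀ β : ℝ, 0 ≤ β → β < 1 → HasMajorantHom (g := toB6 g R H) 𝔬.blk 𝔭.blkPY ((𝔭.ΦY U β ∘ₗ 𝔬.D U) ∘ₗ 𝔬.Gp U)
      (fun (a b : g.Site) => hc β * g.len a ^ (1 - β) * Real.exp (-(δ * g.dist a b)))) :
    (∀ ε : ℝ, 0 < ε → ε ≤ 1 → HasMaj (bHX ε) (BlockNorm.ofBlocks (toB6 g R H) (𝔬.blk ∘ Prod.fst))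
        (familyOp fun p : P × P => 𝔡.Dd U p.1 ∘ₗ (𝔬.Gp U ∘ₗ 𝔡.Dsd U p.2))
        (fun (a b : g.Site) => inputConst44 d₁ δ₁ α₁ NI N' C L₀ (BI ε) (θI ε) * Real.exp (-((1 - α) * δ * g.dist a b)))) ∧
      (∀ ε β : ℝ, 0 < ε → ε ≤ 1 → 0 ≤ β → β < 1 →
        HasMaj (bHX (β + ε)) (BlockNorm.ofBlocks (toB6 g R H) (𝔭.blkPX ∘ Prod.fst))
          (sliceProbe (𝔭.ΦX U β) ∘ₗ familyOp fun p : P × P => 𝔡.Dd U p.1 ∘ₗ (𝔬.Gp U ∘ₗ 𝔡.Dsd U p.2))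
          (fun (a b : g.Site) => inputConst45 d₁ δ₁ α₁ NI N' L₀ (hc β) (BI2 ε β) (θI (β + ε)) * g.len a ^ (-β) *
            Real.exp (-((1 - α) * δ * g.dist a b)))) := by
  have hL₀ : 0 ≤ L₀ := le_trans (le_trans zero_le_one hF.one_le_L) hF.L_le
  have hc1 : 0 ≤ B6.c1 d₁ δ₁ α₁ := c1_nonneg d₁ δ₁ α₁
  have hlen0 : ∀ y : g.Site, 0 ≤ g.len y := fun y => (hs.lenpos y).le
  have hpair := fun p : P × P => inputPair3445_of_local37_dir 𝔬 𝔡 𝔩 𝔭 R H bHX d d₁ δ α L₀ δ₁ α₁ ρ N N' Cℓ NI C κ SI hc BI θI BI2 U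
    hδ₁ hα₁ hN' hNI hC hδle hαδ hαδ1 hs hcntI hhc hBI hBI2 hθI h261 hF hi hIL hFI hDS hDH h1 hHol p.1 p.2
  refine ⟨fun ε hε0 hε1 => ?_, fun ε β hε0 hε1 hβ0 hβ1 => ?_⟩
  · have hK : ∀ a b : g.Site, 0 ≤ inputConst44 d₁ δ₁ α₁ NI N' C L₀ (BI ε) (θI ε) * Real.exp (-((1 - α) * δ * g.dist a b)) := by
      intro a b
      have h1' := hBI ε hε0 hε1
      have h2' := hθI ε hε0
      unfold inputConst44
      positivity
    exact hasMaj_familyOp' (R := R) (H := H) 𝔬.blk hK fun p => (hpair p).1 ε hε0 hε1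
  · have hK : ∀ a b : g.Site, 0 ≤ inputConst45 d₁ δ₁ α₁ NI N' L₀ (hc β) (BI2 ε β) (θI (β + ε)) * g.len a ^ (-β) *
        Real.exp (-((1 - α) * δ * g.dist a b)) := by
      intro a b
      have h1' := hBI2 ε β hε0 hε1 hβ0 hβ1
      have h2' := hθI (β + ε) (by linarith)
      have h3' := hhc β hβ0 hβ1
      have h4' : 0 ≤ g.len a ^ (-β) := Real.rpow_nonneg (hlen0 a) _
      unfold inputConst45
      positivity
    rw [sliceProbe_comp_familyOp]
    exact hasMaj_familyOp' (R := R) (H := H) 𝔭.blkPX hK fun p => (hpair p).2 ε β hε0 hε1 hβ0 hβ1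

end GpSide

end

end Literature.MathematicalPhysics.QuantumFieldTheory.Balaban1983to89.B9RWSums344InputPairDir
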